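import Literature.MathematicalPhysics.QuantumLattice.HubbardSliceSymbolBandIncrementChain
import Literature.MathematicalPhysics.QuantumLattice.HubbardSliceSymbolSmoothXiFourth
import HarnessLib

/-!
# The increment chain of the slice symbol with the `Ψ̂‴`-increment constant DISCHARGED: `K₄ = (128B₄ + 1408B₃ + 7776B₂ + 27648B₁ + 24576)·c/Λ⁵`

Topic `MathematicalPhysics/QuantumLattice`; the one-step composition of `HubbardSliceSymbolBandIncrementChain` (third differences of
`Ψ̂∘(u+w) − Ψ̂∘u` along a line, with the increment constant `K₄` of `Ψ̂‴` as a hypothesis) with `HubbardSliceSymbolSmoothXiFourth`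
(`norm_sliceSymbolFnXiD3_sub_le`: that hypothesis with the explicit `K₄`).  This is the INCREMENT-piece amplitude of the flow-piece telescoping of the
weighted slice propagator (Benfatto–Giuliani–Mastropietro 2006, §3 (3.2)–(3.8)) with all four slice-symbol constants explicit:

* **`norm_fwdDiff_iter_three_sliceSymbolFnXi_incr_le_explicit`** — `‖Δ_δ³(Ψ̂∘(u+w) − Ψ̂∘u)(t)‖ ≤ δ³·[…]` with `K₁ … K₄` the explicit constants
  (`B₁, …, B₄` global bounds of `χ₂′, …, χ₂⁗`; `c ≥ 0`, `0 < Λ ≤ Λ′`, `|θ| ≤ Λ/4`).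

Everything is proved; no definitions; no named facts.

## Sources

G. Benfatto, A. Giuliani, V. Mastropietro, Ann. Henri Poincaré 7 (2006) 809–898, (2.36aa), §3 (3.2)–(3.8) (`BenfattoGiulianiMastropietro2006`).
-/

noncomputable section

namespace Literature.MathematicalPhysics.QuantumLattice

open Literature.Probability.LatticeModels Literature.Analysis.Calculus Set Complex

section IncrChainXi4

variable {c θ Λ Λ' ω : ℝ}

/-- **Third differences of the increment `Ψ̂∘(u+w) − Ψ̂∘u` along a line, all constants explicit** (`K₄` from `norm_sliceSymbolFnXiD3_sub_le`).
[cite: BenfattoGiulianiMastropietro2006, §3 (3.2)] -/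
theorem norm_fwdDiff_iter_three_sliceSymbolFnXi_incr_le_explicit (hΛ : 0 < Λ) (hΛΛ' : Λ ≤ Λ') (hθ : |θ| ≤ Λ / 4) (hc : 0 ≤ c)
    {B₁ B₂ B₃ B₄ : ℝ}
    (hB₁ : ∀ x, |deriv salmhoferCutoff x| ≤ B₁) (hB₂ : ∀ x, |deriv (deriv salmhoferCutoff) x| ≤ B₂)
    (hB₃ : ∀ x, |deriv (deriv (deriv salmhoferCutoff)) x| ≤ B₃) (hB₄ : ∀ x, |deriv (deriv (deriv (deriv salmhoferCutoff))) x| ≤ B₄)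
    {u u₁ u₂ u₃ w w₁ w₂ w₃ : ℝ → ℝ}
    (hu : ∀ t, HasDerivAt u (u₁ t) t) (hu₁ : ∀ t, HasDerivAt u₁ (u₂ t) t) (hu₂ : ∀ t, HasDerivAt u₂ (u₃ t) t)
    (hw : ∀ t, HasDerivAt w (w₁ t) t) (hw₁ : ∀ t, HasDerivAt w₁ (w₂ t) t) (hw₂ : ∀ t, HasDerivAt w₂ (w₃ t) t)
    {D₁ D₂ D₃ W₀ W₁ W₂ W₃ : ℝ} (hD₁ : ∀ t, |u₁ t| ≤ D₁) (hD₂ : ∀ t, |u₂ t| ≤ D₂) (hD₃ : ∀ t, |u₃ t| ≤ D₃)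
    (hW₀ : ∀ t, |w t| ≤ W₀) (hW₁ : ∀ t, |w₁ t| ≤ W₁) (hW₂ : ∀ t, |w₂ t| ≤ W₂) (hW₃ : ∀ t, |w₃ t| ≤ W₃) {δ : ℝ} (hδ : 0 ≤ δ) (t : ℝ) :
    ‖(fwdDiff δ)^[3] (fun s => sliceSymbolFnXi c θ Λ Λ' ω (u s + w s) - sliceSymbolFnXi c θ Λ Λ' ω (u s)) t‖ ≤
      δ ^ 3 * ((128 * B₄ + 1408 * B₃ + 7776 * B₂ + 27648 * B₁ + 24576) * c / Λ ^ 5 * W₀ * (D₁ + W₁) ^ 3 +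
        (64 * B₃ + 480 * B₂ + 1728 * B₁ + 1536) * c / Λ ^ 4 * (W₁ * (3 * D₁ ^ 2 + 3 * D₁ * W₁ + W₁ ^ 2)) +
        3 * ((64 * B₃ + 480 * B₂ + 1728 * B₁ + 1536) * c / Λ ^ 4 * W₀ * ((D₁ + W₁) * (D₂ + W₂)) +
          (32 * B₂ + 144 * B₁ + 128) * c / Λ ^ 3 * (D₁ * W₂ + W₁ * D₂ + W₁ * W₂)) +
        ((32 * B₂ + 144 * B₁ + 128) * c / Λ ^ 3 * W₀ * (D₃ + W₃) + (16 * B₁ + 16) * c / Λ ^ 2 * W₃)) :=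
  norm_fwdDiff_iter_three_sliceSymbolFnXi_incr_le hΛ hΛΛ' hθ hc hB₁ hB₂ hB₃
    (fun x y => norm_sliceSymbolFnXiD3_sub_le (ω := ω) hΛ hΛΛ' hθ hc hB₁ hB₂ hB₃ hB₄ x y)
    hu hu₁ hu₂ hw hw₁ hw₂ hD₁ hD₂ hD₃ hW₀ hW₁ hW₂ hW₃ hδ t

end IncrChainXi4

end Literature.MathematicalPhysics.QuantumLattice

end
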